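import Literature.NumberTheory.DiophantineGeometry.AbelianSchemeModelReduction
import Literature.AlgebraicGeometry.Motives.AbelianVarietyRationalTorsionReduction
import Literature.NumberTheory.Automorphic.AdicCompletionResidueCard
import HarnessLib

/-!
# The reduction map at a place of good reduction: an arithmetic Frobenius reduces to the Frobenius endomorphism

[Serre–Tate 1968, §1, Lemma 2] «This isomorphism commutes with the action of `D(v̄)`»; [Shimura 1998, §19.4
(19.4a), p. 133]: «`(t^σ)~ = φ_𝔭(t̃)` for every `t`», `σ` a Frobenius automorphism for `𝔓`, `φ_𝔭` the
`N(𝔭)`-th power (Frobenius) endomorphism of the reduction.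

Layer `Literature/NumberTheory/DiophantineGeometry`, namespace `Literature.NumberTheory.DiophantineGeometry`.
KERNEL ONLY: theorems; no definition, no instance, no named fact.  Cell `hodgecm-mathlib`, background programme
R-pkg (director BATCH 67/68, lead B-p20, `B-provers/B-p20/SPEC-Rpkg.md`), piece **T5 «Frobenius, (19.4a)»**: field
(b) (`equiv_smul`) of the tree's `GoodReductionAt.TateSpecialisation` for the good-reduction datum PRODUCED by an
abelian-scheme model `𝒜` of `A` at `v` (`IsAbelianSchemeModel A v 𝒜`), at the point level and for ALL geometric
points (no torsion hypothesis): for `σ ∈ Γ_K` an arithmetic Frobenius at the prime `𝔓₀ = adicCompletionPrime K v`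
above `v` cut out by the chosen embedding `K̄ → \bar K_v`, and `x ∈ A(K̄)`,
`red_v (σ • x) = π_{Ā}(red_v x)`, `red_v = h.specialFibreReductionHom` the tree's reduction map
(`DiophantineGeometry/AbelianSchemeModelReduction`, Serre–Tate's reduction over the rank-one valuation ring of
`\bar K_v`) and `π_Ā = frobeniusHom h.specialFibre` the Frobenius endomorphism of the special fibre over `κ(v)`.

Everything is by name: `σ ∈ D(𝔓₀) = res(Γ_{K_v})` (Mathlib `IsArithFrobAt.mem_stabilizer`,
`decompositionSubgroup_adicCompletionPrime_eq_range`), so `σ = res τ`; `τ` is an arithmetic Frobenius of the LOCAL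
field `K_v` (`isArithFrobAt_absGaloisRestrict_adicCompletionPrime_iff`, with `q_v` matched by
`residueFieldCard_adicCompletion_eq`); `red_v` is `Γ_{K_v}`-equivariant (`specialFibreReductionHom_smul`); an
arithmetic Frobenius `τ` of `K_v` induces `y ↦ y^{q_v}` on the residue field `κ(R)` of `\bar K_v`
(`residueFieldMap_apply_eq_pow_of_isAbsArithFrob`, from Mathlib's `IsArithFrobAt` on the absolute integers) —
hence, transported to the geometric points `𝒜_v(κ̄(v))` of the special fibre along the tree's identifications
`residueFieldPointsEquiv` / `specialFibrePointsEquiv` (universal property of the fibre product, naturality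
`Adjunction.homEquiv_naturality_left`), it IS the arithmetic Frobenius `x ↦ x^{q_v}` of `κ̄(v)/κ(v)`
(`specialFibreGeomPoints_smul_eq_arithFrob_smul_of_isAbsArithFrob`), which acts on `𝒜_v(κ̄(v))` as the Frobenius
ENDOMORPHISM `π_Ā` (`geomPointsMap_frobeniusHom_eq_arithFrob_smul`, `Motives/AbelianVarietyRationalTorsionReduction`).

## Main statements
* `residueFieldMap_apply_eq_pow_of_isAbsArithFrob` — local field `F`: `τ̄ y = y ^ q_F` on `κ(R)`.
* `IsAbelianSchemeModel.specialFibreGeomPoints_smul_eq_arithFrob_smul_of_isAbsArithFrob` — the transported action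
  of a local Frobenius `τ` on `𝒜_v(κ̄(v))` is the arithmetic Frobenius of `κ̄(v)/κ(v)`.
* `IsAbelianSchemeModel.specialFibreReductionHom_smul_of_isArithFrobAt` — **(19.4a)**:
  `red_v (σ • x) = π_Ā (red_v x)`.

## References
* [SerreTate1968GoodReduction] J.-P. Serre, J. Tate, *Good reduction of abelian varieties*, Ann. of Math. 88
  (1968), §1 Lemma 2.
* [Shimura1998] G. Shimura, *Abelian Varieties with Complex Multiplication and Modular Functions* (1998), §19.4
  (19.4a) and Lemma 19.5, p. 133; §16.3 (1).
* [NeukirchANT1999] J. Neukirch, *Algebraic Number Theory* (1999), Ch. I §9 (9.4)–(9.6); Ch. II §9 (9.6).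
-/

set_option autoImplicit false

noncomputable section

open CategoryTheory CategoryTheory.Limits AlgebraicGeometry NumberField IsDedekindDomain
open IsDedekindDomain.HeightOneSpectrum
open ValuativeRel Field IsLocalRing
open scoped MonObj NumberField CategoryTheory.Obj
open Literature.AlgebraicGeometry.Motives (AbelianVariety SchemeOver residueAt residueAt_surjective
  residueFieldEquiv specOver specRingHomOver specRingHomOverMap AlgPoints arithFrob)
open Literature.NumberTheory.GaloisRepresentations
open Literature.NumberTheory.GaloisRepresentations.IsNonarchimedeanLocalField (residueFieldCard absMaximalIdeal
  card_quotient_under_absMaximalIdeal_holds mem_absMaximalIdeal_iff_algNorm_lt_one)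
open Literature.NumberTheory.EllipticCurves

/-! ## §1 Local fields: an arithmetic Frobenius of `F` is `y ↦ y ^ q_F` on the residue field of `F̄` -/

namespace Literature.NumberTheory.GaloisRepresentations

section LocalFrobenius

universe u

variable {F : Type u} [Field F] [ValuativeRel F] [TopologicalSpace F] [IsNonarchimedeanLocalField F]

/-- **An arithmetic Frobenius of the local field `F` induces `y ↦ y ^ q_F` on the residue field `κ(R)` of the
valuation ring `R` of `F̄`**: for `τ ∈ Γ_F` with `τ • x ≡ x ^ q_F (mod 𝔓)` on the absolute integers
(`IsAbsArithFrob`, Mathlib `IsArithFrobAt` at `𝔓 = absMaximalIdeal F`, exponent `#(𝒪_F ⧸ 𝔓 ∩ 𝒪_F) = q_F` by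
`card_quotient_under_absMaximalIdeal_holds`), `τ̄ ȳ = ȳ ^ q_F` for every `y ∈ R` — `R` and the absolute integers
are the same subring (`mem_closureValuationSubring_iff_mem_absIntegers`) and `𝔓`, `𝔪_R` are both the open unit ball
(`mem_absMaximalIdeal_iff_algNorm_lt_one`, `mem_maximalIdeal_closureValuationSubring_iff`).  Neukirch Ch. I §9
(9.4): «`φ_𝔓` … `a ↦ a^q mod 𝔓`». [cite: NeukirchANT1999, Ch. I §9 (9.4)] [cite: SerreLocalFields1979, Ch. I §8] -/
theorem residueFieldMap_apply_eq_pow_of_isAbsArithFrob {τ : absoluteGaloisGroup F} (hτ : IsAbsArithFrob τ)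
    (y : ResidueField (closureValuationSubring F)) :
    residueFieldMap τ y = y ^ residueFieldCard F := by
  obtain ⟨x, rfl⟩ := IsLocalRing.residue_surjective y
  rw [residueFieldMap_residue, ← map_pow, ← sub_eq_zero, ← map_sub, IsLocalRing.residue_eq_zero_iff,
    mem_maximalIdeal_closureValuationSubring_iff]
  have hx : (x : AlgebraicClosure F) ∈ absIntegers 𝒪[F] F :=
    mem_closureValuationSubring_iff_mem_absIntegers.mp x.2
  have h : τ • (⟨x, hx⟩ : absIntegers 𝒪[F] F) -
      ⟨x, hx⟩ ^ Nat.card (𝒪[F] ⧸ (absMaximalIdeal F).under 𝒪[F]) ∈ absMaximalIdeal F := hτ ⟨x, hx⟩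
  rw [show Nat.card (𝒪[F] ⧸ (absMaximalIdeal F).under 𝒪[F]) = residueFieldCard F from
      card_quotient_under_absMaximalIdeal_holds F, mem_absMaximalIdeal_iff_algNorm_lt_one] at h
  convert h using 2
  simp only [AddSubgroupClass.coe_sub, SubmonoidClass.coe_pow, coe_closureValuationSubringMap,
    integralClosure.coe_smul]

end LocalFrobenius

end Literature.NumberTheory.GaloisRepresentations

/-! ## §2 The transported action on `𝒜_v(κ̄(v))` and (19.4a) -/

namespace Literature.NumberTheory.DiophantineGeometry

variable {K : Type} [Field K] [NumberField K] {v : HeightOneSpectrum (𝓞 K)}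
  {A : AbelianVariety K} {𝒜 : SchemeOver (valuationSubringAtPrime K v)} [GrpObj 𝒜]

variable (v) in
/-- **The Frobenius square on the geometric closed point**: for `τ ∈ Γ_{K_v}` with `τ̄ = (y ↦ y^q)` on `κ(R)`,
`q = #κ(v)`, the automorphism `Spec τ̄` of `Spec κ(R)` corresponds, under the identifications
`Spec κ(R) ≅ Spec κ̄(v)` (`geomClosedPointIsoSpecResidueField`) and `geomClosedPointIso`, to `Spec` of the
arithmetic Frobenius `x ↦ x^q` of `κ̄(v)/κ(v)` — because `e⁻¹(y^q) = (e⁻¹ y)^q` for the chosen `κ(v)`-isomorphism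
`e : κ̄(v) ≃ κ(R)`. [cite: NeukirchANT1999, Ch. I §9 (9.4)] -/
theorem geomClosedPointIso_inv_comp_specResidueFieldMap_of_forall_eq_pow
    {τ : absoluteGaloisGroup (v.adicCompletion K)}
    (hτ : ∀ y, residueFieldMap τ y = y ^ Nat.card v.asIdeal.ResidueField) :
    (geomClosedPointIso v).inv ≫ (geomClosedPointIsoSpecResidueField v).inv ≫ specResidueFieldMap v τ =
      (Over.map (specResidueField v)).map
          (AlgPoints.specMap (absoluteGaloisGroup.toAlgEquiv v.asIdeal.ResidueField
            (arithFrob v.asIdeal.ResidueField))) ≫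
        (geomClosedPointIso v).inv ≫ (geomClosedPointIsoSpecResidueField v).inv := by
  ext : 1
  simp only [Over.comp_left, Over.map_map_left, AlgPoints.specMap_left]
  change 𝟙 _ ≫ Spec.map (CommRingCat.ofHom (geomResidueFieldEquiv v).symm.toRingEquiv.toRingHom) ≫
      Spec.map (CommRingCat.ofHom (residueFieldMap τ)) =
    Spec.map _ ≫ 𝟙 _ ≫ Spec.map (CommRingCat.ofHom (geomResidueFieldEquiv v).symm.toRingEquiv.toRingHom)
  rw [Category.id_comp, Category.id_comp, ← Spec.map_comp, ← Spec.map_comp, ← CommRingCat.ofHom_comp,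
    ← CommRingCat.ofHom_comp]
  congr 2
  ext y
  change (geomResidueFieldEquiv v).symm (residueFieldMap τ y) =
    absoluteGaloisGroup.toAlgEquiv v.asIdeal.ResidueField (arithFrob v.asIdeal.ResidueField)
      ((geomResidueFieldEquiv v).symm y)
  rw [hτ, map_pow, ← absoluteGaloisGroup.smul_def, Literature.AlgebraicGeometry.Motives.arithFrob_smul]

/-- **The transported action of a local arithmetic Frobenius on `𝒜_v(κ̄(v))` is the arithmetic Frobenius of
`κ̄(v)/κ(v)`** ([Serre–Tate 1968] §1: «`D(v̄)` acts on `T` through its homomorphic image `Gal(k̄/k)`»): for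
`τ ∈ Γ_{K_v}` an arithmetic Frobenius of `K_v` (`IsAbsArithFrob τ`) and a geometric point `Q` of the special fibre
abelian variety `𝒜_v = h.specialFibre`, the action of `τ` (the tree's `h.specialFibreGeomPointsAction`, through
`Γ_{K_v} → Aut(κ(R)/κ(v))` and `𝒜(κ(R)) ≃ 𝒜_v(κ̄(v))`) is the action of `φ = (x ↦ x^{q_v}) ∈ Gal(κ̄(v)/κ(v))`
(`arithFrob κ(v)`; `q_v = #κ(v)` by `residueFieldCard_adicCompletion_eq` and `natCard_residueField`).
[cite: SerreTate1968GoodReduction, §1 (before Thm. 1) and Lemma 2] [cite: NeukirchANT1999, Ch. I §9 (9.4)] -/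
theorem IsAbelianSchemeModel.specialFibreGeomPoints_smul_eq_arithFrob_smul_of_isAbsArithFrob
    (h : IsAbelianSchemeModel A v 𝒜) {τ : absoluteGaloisGroup (v.adicCompletion K)} (hτ : IsAbsArithFrob τ)
    (Q : h.specialFibre.geomPoints) :
    (letI := h.specialFibreGeomPointsAction; τ • Q) = arithFrob v.asIdeal.ResidueField • Q := by
  letI := h.specialFibreGeomPointsAction
  -- `τ̄ = (y ↦ y ^ q_v)` on `κ(R)`, with `q_v = #κ(v)`
  have hq : ∀ y, residueFieldMap τ y = y ^ Nat.card v.asIdeal.ResidueField := fun y => by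
    rw [residueFieldMap_apply_eq_pow_of_isAbsArithFrob hτ,
      Literature.NumberTheory.Automorphic.residueFieldCard_adicCompletion_eq K v,
      Literature.AlgebraicGeometry.Motives.natCard_residueField v]
  rw [h.specialFibreGeomPoints_smul_def]
  obtain ⟨P, rfl⟩ := h.additiveResidueFieldPointsEquiv.surjective Q
  rw [AddEquiv.symm_apply_apply]
  apply Additive.toMul.injective
  rw [Literature.AlgebraicGeometry.Motives.AbelianVariety.toMul_smul]
  change (residueFieldPointsEquiv v 𝒜).trans h.specialFibrePointsEquiv (τ • Additive.toMul P) =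
    arithFrob v.asIdeal.ResidueField • (residueFieldPointsEquiv v 𝒜).trans h.specialFibrePointsEquiv (Additive.toMul P)
  set P₀ := Additive.toMul P with hP₀
  rw [MulEquiv.trans_apply, MulEquiv.trans_apply, residueFieldPoints.smul_def]
  -- move `Spec τ̄` across the two identifications `Spec κ(R) ≅ Spec κ̄(v) ≅ (Over.map _).obj (Spec κ̄(v))`
  have hre : (geomClosedPointIso v).inv ≫ ((geomClosedPointIsoSpecResidueField v).inv ≫
        (specResidueFieldMap v τ ≫ P₀) ≫ (Iso.refl 𝒜).hom) =
      (Over.map (specResidueField v)).map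
          (AlgPoints.specMap (absoluteGaloisGroup.toAlgEquiv v.asIdeal.ResidueField
            (arithFrob v.asIdeal.ResidueField))) ≫
        ((geomClosedPointIso v).inv ≫ ((geomClosedPointIsoSpecResidueField v).inv ≫ P₀ ≫ (Iso.refl 𝒜).hom)) := by
    have key := geomClosedPointIso_inv_comp_specResidueFieldMap_of_forall_eq_pow v hq
    simp only [← Category.assoc] at key ⊢
    rw [key]
  conv_lhs => rw [h.specialFibrePointsEquiv_apply]
  change (Over.mapPullbackAdj (specResidueField v)).homEquiv _ 𝒜
      ((geomClosedPointIso v).inv ≫ ((geomClosedPointIsoSpecResidueField v).inv ≫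
        (specResidueFieldMap v τ ≫ P₀) ≫ (Iso.refl 𝒜).hom)) = _
  rw [hre, Adjunction.homEquiv_naturality_left]
  conv_rhs => rw [AlgPoints.absoluteGaloisGroup_smul_def, h.specialFibrePointsEquiv_apply]
  rfl

/-- **… hence it is the Frobenius ENDOMORPHISM `π_Ā` of the special fibre** (`π_Ā` acts on `Ā(κ̄)` as the arithmetic
Frobenius, `geomPointsMap_frobeniusHom_eq_arithFrob_smul`; Shimura §16.3 (1) «`(t^σ)~ = t̃^q = πt̃`»).
[cite: Shimura1998, §16.3 (1) and §19.4 (19.4a)] [cite: SerreTate1968GoodReduction, §1 Lemma 2] -/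
theorem IsAbelianSchemeModel.specialFibreGeomPoints_smul_eq_geomPointsMap_frobeniusHom
    (h : IsAbelianSchemeModel A v 𝒜) {τ : absoluteGaloisGroup (v.adicCompletion K)} (hτ : IsAbsArithFrob τ)
    (Q : h.specialFibre.geomPoints) :
    (letI := h.specialFibreGeomPointsAction; τ • Q) =
      AbelianVariety.Hom.geomPointsMap (AbelianVariety.frobeniusHom h.specialFibre) Q := by
  rw [h.specialFibreGeomPoints_smul_eq_arithFrob_smul_of_isAbsArithFrob hτ,
    AbelianVariety.geomPointsMap_frobeniusHom_eq_arithFrob_smul]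

/-- **(19.4a) «`(t^σ)~ = φ_𝔭(t̃)`»: an arithmetic Frobenius at `𝔓₀ ∣ v` reduces to the Frobenius endomorphism.**
For an abelian-scheme model `𝒜` of `A` at `v`, `σ ∈ Γ_K` an arithmetic Frobenius at the prime
`𝔓₀ = adicCompletionPrime K v` of `\bar ℤ_K` above `v` (Mathlib `IsArithFrobAt (𝓞 K) σ 𝔓₀`), and ANY geometric point
`x ∈ A(K̄)`: `red_v (σ • x) = π_Ā (red_v x)` for the reduction map `red_v = h.specialFibreReductionHom` and the
Frobenius endomorphism `π_Ā = frobeniusHom h.specialFibre` of the special fibre over `κ(v)`.  Proof: `σ ∈ D(𝔓₀)`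
(`IsArithFrobAt.mem_stabilizer`) `= res(Γ_{K_v})` (`decompositionSubgroup_adicCompletionPrime_eq_range`), so
`σ = res τ` with `τ` an arithmetic Frobenius of `K_v` (`isArithFrobAt_absGaloisRestrict_adicCompletionPrime_iff`);
`red_v` is `Γ_{K_v}`-equivariant (`specialFibreReductionHom_smul`); and `τ` acts on `𝒜_v(κ̄(v))` as `π_Ā`
(`specialFibreGeomPoints_smul_eq_geomPointsMap_frobeniusHom`).  This is field (b) of the tree's
`GoodReductionAt.TateSpecialisation` at the point level, for the produced datum.
[cite: Shimura1998, §19.4 (19.4a) and Lemma 19.5 (p. 133)] [cite: SerreTate1968GoodReduction, §1 Lemma 2]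
[cite: NeukirchANT1999, Ch. II §9 Prop. (9.6)] -/
theorem IsAbelianSchemeModel.specialFibreReductionHom_smul_of_isArithFrobAt
    (h : IsAbelianSchemeModel A v 𝒜) {σ : absoluteGaloisGroup K}
    (hσ : IsArithFrobAt (𝓞 K) σ (adicCompletionPrime K v)) (x : A.geomPoints) :
    h.specialFibreReductionHom (σ • x) =
      AbelianVariety.Hom.geomPointsMap (AbelianVariety.frobeniusHom h.specialFibre) (h.specialFibreReductionHom x) := by
  -- `σ ∈ D(𝔓₀) = res (Γ_{K_v})`
  have hmem : σ ∈ (adicCompletionPrime K v).decompositionSubgroup (absoluteGaloisGroup K) :=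
    hσ.mem_stabilizer
  rw [decompositionSubgroup_adicCompletionPrime_eq_range] at hmem
  obtain ⟨τ, rfl⟩ := hmem
  -- `τ` is an arithmetic Frobenius of the local field `K_v`
  have hq : residueFieldCard (v.adicCompletion K) = Nat.card (𝓞 K ⧸ v.asIdeal) := by
    rw [Literature.NumberTheory.Automorphic.residueFieldCard_adicCompletion_eq K v, residueCard_eq_card_quotient]
  have hτ : IsAbsArithFrob τ :=
    (isArithFrobAt_absGaloisRestrict_adicCompletionPrime_iff K v hq τ).mp hσ
  -- equivariance of `red_v` and the action of `τ` on the special fibre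
  change h.specialFibreReductionHom (absGaloisRestrict K (v.adicCompletion K) τ • x) = _
  rw [h.specialFibreReductionHom_smul]
  exact h.specialFibreGeomPoints_smul_eq_geomPointsMap_frobeniusHom hτ _

end Literature.NumberTheory.DiophantineGeometry

end
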